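import Summits.AtomisticToContinuum.Crystallization.Theorems.FrustratedLawDichotomyStrainedPatchHomValueT2Kit

/-!
# (I1) part H — soundness of the VALUE AT THE CENTRE POINT (`…HomValueT2Kit.valueP`): the bisection invariant and ★ `valueP_sound` — `v/SC` is a floor of
# the full `hver` energy at the box-centre pair `(cenMap c, cenShuf c)`, GIVEN `‖cenMap c − 1‖ ≤ 1/4` (the hypothesis the table leaf needs at the centre; the kit's
# successor adds a kernel guard for it) (27623 `(H) HomFloor`, hcp half; decomp-a2c hand-1 g41; FINDING-hand-1-g41 §6 (R5), I1-ROADMAP-g41 §3).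

No definitions; 0 sorry; standard axioms; no instances / notation / `#eval`.  `--supports stmt-AtomisticToContinuum-27623`.
-/

noncomputable section

namespace Summit.AtomisticToContinuum.Crystallization.Theorems.FrustratedLawDichotomyStrainedPatchHomValueT2Kit

open scoped BigOperators RealInnerProductSpace
open Literature.Analysis.ValidatedNumerics.Numerics
open Summit.AtomisticToContinuum.Crystallization.Theorems.ChargedEnergyGapNegative (E3)
open Summit.AtomisticToContinuum.Crystallization.Theorems.FrustratedLawDichotomySchurCut (effPot w₄₅ ω₄)
open Summit.AtomisticToContinuum.Crystallization.Theorems.FrustratedLawDichotomyStrainedPatchHomSplit (latPt hexFrame hcpShift)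
open Summit.AtomisticToContinuum.Crystallization.Theorems.FrustratedLawDichotomyStrainedPatchHomCurvCentreKit (cenMap cenShuf zW cenMap_box cenShuf_box)
open Summit.AtomisticToContinuum.Crystallization.Theorems.FrustratedLawDichotomyStrainedPatchHomLeafTableCheckHcpV (tableLeafOKHV leafCheckV_sound_hcp lvOf_mem)
open Summit.AtomisticToContinuum.Crystallization.Theorems.FrustratedLawDichotomyStrainedPatchHomEntryTableHcp (abs_le_of_shufInOK sgnZ_two_natAbs)
open Summit.AtomisticToContinuum.Crystallization.Theorems.FrustratedLawDichotomyStrainedPatchHomLeafTableCheckHcp (tabSem_of_allOKK)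
open Summit.AtomisticToContinuum.Crystallization.Theorems.FrustratedLawDichotomyStrainedPatchHomLeafTableCheck (qTableK1 qTableK1_allOKK tabE)

/-! ## §1. The bisection keeps a passing target -/

/-- ★ `bisectUp f a b n` passes `f` whenever the start `a` does. [formal bookkeeping] -/
theorem bisectUp_true (f : ℤ → Bool) : ∀ (n : ℕ) (a b : ℤ), f a = true → f (bisectUp f a b n) = true := by
  intro n
  induction n with
  | zero => intro a b ha; simpa [bisectUp] using ha
  | succ n ih =>
    intro a b ha
    simp only [bisectUp]
    split_ifs with hmid
    · exact ih _ _ hmid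
    · exact ih _ _ ha

/-- `valueP μ c = some v` ⟹ the table leaf passes at target `v` on the zero-width box. [formal bookkeeping] -/
theorem tableLeaf_of_valueP {μ : ℤ} {c : (Fin 3 × Fin 3) ⊕ Fin 3 → ℤ} {v : ℤ} (h : valueP μ c = some v) :
    tableLeafOKHV qTableK1 tabE v c zW = true := by
  unfold valueP at h
  dsimp only at h
  split at h
  · rename_i hlo
    cases h
    exact bisectUp_true (fun m => tableLeafOKHV qTableK1 tabE m c zW) 30 (μ - 17592186044416) (μ + 17592186044416) hlo
  · exact absurd h (by simp)

/-! ## §2. ★ The value floor at the centre -/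

/-- ★★ **VALUE AT THE CENTRE**: if `valueP μ c = some v` and the centre self-map is within `1/4` of the identity, then `v/SC` is below the full two-family
`hver` energy at `(U_c, ξ_c) = (cenMap c, cenShuf c)`. [folklore chaining: `leafCheckV_sound_hcp` on the zero-width box] -/
theorem valueP_sound {μ : ℤ} {c : (Fin 3 × Fin 3) ⊕ Fin 3 → ℤ} {v : ℤ} (h : valueP μ c = some v) (hU : ‖cenMap c - 1‖ ≤ 1 / 4) :
    (v : ℝ) / SC ≤ (∑ b ∈ (Fintype.piFinset fun _ : Fin 3 => Finset.Icc (-7 : ℤ) 7).filter (fun b => b ≠ 0), effPot w₄₅ ω₄ (3 / 400) ‖latPt (cenMap c) hexFrame b‖) +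
      ∑ b ∈ (Fintype.piFinset fun _ : Fin 3 => Finset.Icc (-7 : ℤ) 7), effPot w₄₅ ω₄ (3 / 400) ‖latPt (cenMap c) hexFrame b + (cenMap c) (hcpShift + cenShuf c)‖ := by
  have htab := tableLeaf_of_valueP h
  simp only [tableLeafOKHV, Bool.and_eq_true] at htab
  obtain ⟨hin, hleaf⟩ := htab
  have hbox : ∀ ab : Fin 3 × Fin 3, |(cenMap c (EuclideanSpace.single ab.2 (1 : ℝ))) ab.1 - (c (Sum.inl ab) : ℝ) / SC| ≤ ((zW (Sum.inl ab) : ℤ) : ℝ) / SC :=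
    fun ab => by simpa [zW] using cenMap_box c ab
  have hξ : ∀ i : Fin 3, |cenShuf c i - (c (Sum.inr i) : ℝ) / SC| ≤ ((zW (Sum.inr i) : ℤ) : ℝ) / SC := cenShuf_box c
  obtain ⟨hV, hη⟩ := lvOf_mem (cenMap c) (cenShuf c) hbox hξ
  have key := leafCheckV_sound_hcp (tabSem_of_allOKK qTableK1_allOKK) hleaf (cenMap c) hU (cenShuf c) (abs_le_of_shufInOK hin hξ) hV hη
  rw [sgnZ_two_natAbs] at key
  push_cast at key
  have e : 2 * (v : ℝ) / SC / 2 = (v : ℝ) / SC := by ring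
  rw [e] at key
  exact key

end Summit.AtomisticToContinuum.Crystallization.Theorems.FrustratedLawDichotomyStrainedPatchHomValueT2Kit
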